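import Summits.QuantumFields.BalabanUV.Beta.SecondOrderBorderParity
import Summits.QuantumFields.BalabanUV.Beta.SpineRecursivePureParity
import Summits.QuantumFields.BalabanUV.Beta.BorderedHessianStepParity
import Summits.QuantumFields.BalabanUV.Beta.SecondOrderStepLaw

/-!
# `BalabanUV.Beta.SecondOrderBorderNoModel` — binder row D1, (L4): **NO TWIN MODEL OF THE BORDER SOCKET** (owner NOTE X-an2-46 made a
# theorem, referee request I-d1ref11-1): with a TWIN (parity-odd, `packVH`-type) border table and a parity-odd residual, the END's two border
# blocks (hBfm)/(hBmf) force the canonical similarity kernel to VANISH on the border; reading the field–multiplier entry at the α-bond `(α, u)`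
# against a multiplier leg of direction `m ≠ α` and a second bond of direction `κ′ ≠ α`, this says `γ_j · S′(u, inl α; z, inr m) = 0` — so ONE
# non-zero such entry of the first-order border table (`SpureRecAt j κ′ u′`, at level `0`: `cVH · vhSAt ρ κ′ u′`) refutes every twin model
# (β sub-cell, row BETA-an2 = BINDER-OWNERS row D1 OWNER, lineage an2 gen 19)

HONEST FRAMING (cell charter, verbatim): «discharging BetaPertH makes Balaban's UV stability UNCONDITIONAL — a real
constructive-QFT result; it is NOT the continuum limit and NOT the Clay problem.»  Neutral kernel algebra ([folklore]), entrywise; no statement of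
Bałaban's papers, no `[cite:]`, no `def`, no `Prop` fact; instantiates no binder of the wall.  NOT D1, NOT `BetaPertH`, NOT continuum, NOT Clay.

## What is proved
* §1 `antiTwin_of_parityEven`: a row-parity-even kernel is anti-twin on the border; `conjW_canon_antiTwin`: the canonical similarity kernel
  is anti-twin on the border; **`conjW_canon_fm_eq_zero_of_twin_border_letter`**: for
  border-twin `S`, `S′`, border-anti-twin `𝕄`, diagonal symbols `g`, `g′` and the CANONICAL second symbol `g·g′`, twin tables `B₁`, `B₀`, an odd
  `RB`, `c ≠ 0` and both border blocks of the letter, EVERY field–multiplier entry of `conjW 𝕄 S S′ (diagK g) (diagK g′) (diagK (g·g′))` vanishes: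
  `S′·(g(z,m) − g(x,β)) + S·(g′(z,m) − g′(x,β)) + 𝕄·(g(x,β) − g(z,m))(g′(x,β) − g′(z,m)) = 0` (the kernel is anti-twin by the parities, twin by
  `SecondOrderBorderParity.twin_of_border_letter`).
* §2 THE WALL READING (generic `d`, in-block root, any level `j`, any `cE cVH cΛ`, any `γ`): **`wall_border_entry_eq_zero_of_twin_letter`** — if the
  border letter of the END holds at `(j, α)` for a twin `vh₂S` with an odd `RB j α`, then for all `u κ′ u′ z m` with `κ′ ≠ α`, `m ≠ α`:
  `γ j · SpureRecAt j κ′ u′ u z (inl α) (inr m) = 0`; and **`no_twin_border_model`**: `γ j ≠ 0` and ONE entry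
  `SpureRecAt j κ′ u′ u z (inl α) (inr m) ≠ 0` (`κ′ ≠ α`, `m ≠ α`) exclude every such pair (`vh₂S`, `RB j α`).
NOT HERE: the non-zero entry itself (a counting fact about an1's `vhSAt` = `(2Lc^{2(d+1)})⁻¹·vhCountAt`, requested from the an1 lane; at `Lc = 1`
the border tables degenerate — the wall has `2 ≤ Lc`).
Provenance: β sub-cell, unit beta-an2 gen 19, 2026-08-20 (v1); no existing file touched.
-/

open Finset
open scoped BigOperators
open Literature.MathematicalPhysics.QuantumFieldTheory
open Literature.MathematicalPhysics.QuantumFieldTheory.Balaban1983to89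
open Literature.MathematicalPhysics.QuantumFieldTheory.Balaban1983to89.Beta
open ExpKernelCalculus (MKer)
open AffineAveraging (box toSite)
open PolarizationSign (reflSign)
open KernelReflection (LegMap refK refK_apply)
open ResolventReflection (bref Φ reflSign_mul_self)
open OneStepResolventKernel (Fib)
open BalabanStepW2 (wB2)
open Summit.QuantumFields.BalabanUV.Beta.TameKernelCalculus
open Summit.QuantumFields.BalabanUV.Beta.ChartConjugation (conjW)
open Summit.QuantumFields.BalabanUV.Beta.BorderedHessian (sgnK sgnK_apply sgnF_inl sgnF_inr diagK ctGen ctGen_inl ctGen_inr bhKStepAt)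
open Summit.QuantumFields.BalabanUV.Beta.SecondOrderStepLaw (conjW_diag_apply)
open Summit.QuantumFields.BalabanUV.Beta.SecondOrderBorderParity (twin_of_border_letter twin_of_parityOdd)
open Summit.QuantumFields.BalabanUV.Beta.SpineRecursivePureParity (trK_SpureRecAt)
open Summit.QuantumFields.BalabanUV.Beta.BorderedHessianStepParity (trK_bhKStepAt)
open Summit.QuantumFields.BalabanUV.Beta.SpineRooted (SpureRecAt)

namespace Summit.QuantumFields.BalabanUV.Beta.SecondOrderBorderNoModel

noncomputable section

variable {d : ℕ}

/-! ## §1 The canonical similarity kernel vanishes on the border of a twin model -/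

/-- [folklore] A row-parity-even kernel is ANTI-twin on the border blocks: `M z x (inr m) (inl β) = −M x z (inl β) (inr m)`. -/
theorem antiTwin_of_parityEven {M : MKer (d + 1) (Fib d)} (h : trK M = sgnK M) (x z : Fin (d + 1) → ℤ) (β m : Fin (d + 1)) :
    M z x (Sum.inr m) (Sum.inl β) = -M x z (Sum.inl β) (Sum.inr m) := by
  have e := congrFun (congrFun (congrFun (congrFun h x) z) (Sum.inl β)) (Sum.inr m)
  rw [trK_apply, sgnK_apply, sgnF_inl, sgnF_inr] at e
  linarith

section Abstract

variable {Φ : LegMap (d + 1) (Fib d)} {𝕄 S S' B₁ B₀ RB : MKer (d + 1) (Fib d)} {g g' : (Fin (d + 1) → ℤ) → Fib d → ℝ} {b c : ℝ}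

/-- [folklore] **THE CANONICAL SIMILARITY KERNEL IS ANTI-TWIN ON THE BORDER**: for border-twin `S`, `S′`, border-anti-twin `𝕄` and
diagonal symbols `g`, `g′` with the canonical second symbol `g·g′`,
`(conjW 𝕄 S S′ (diagK g) (diagK g′) (diagK (g·g′))) z x (inr m) (inl β) = −(conjW …) x z (inl β) (inr m)` (entrywise, `conjW_diag_apply`). -/
theorem conjW_canon_antiTwin
    (hS : ∀ (x z : Fin (d + 1) → ℤ) (β m : Fin (d + 1)), S z x (Sum.inr m) (Sum.inl β) = S x z (Sum.inl β) (Sum.inr m))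
    (hS' : ∀ (x z : Fin (d + 1) → ℤ) (β m : Fin (d + 1)), S' z x (Sum.inr m) (Sum.inl β) = S' x z (Sum.inl β) (Sum.inr m))
    (h𝕄 : ∀ (x z : Fin (d + 1) → ℤ) (β m : Fin (d + 1)), 𝕄 z x (Sum.inr m) (Sum.inl β) = -𝕄 x z (Sum.inl β) (Sum.inr m))
    (x z : Fin (d + 1) → ℤ) (β m : Fin (d + 1)) :
    conjW 𝕄 S S' (diagK g) (diagK g') (diagK fun p a => g p a * g' p a) z x (Sum.inr m) (Sum.inl β) =
      -conjW 𝕄 S S' (diagK g) (diagK g') (diagK fun p a => g p a * g' p a) x z (Sum.inl β) (Sum.inr m) := by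
  rw [conjW_diag_apply, conjW_diag_apply, hS x z β m, hS' x z β m, h𝕄 x z β m]
  ring

/-- [folklore] **THE CANONICAL SIMILARITY KERNEL VANISHES ON THE BORDER OF A TWIN MODEL.**  Border-twin `S`, `S′`, border-anti-twin `𝕄`,
twin `B₁`, `B₀`, odd `RB`, `c ≠ 0`, and both border blocks of the letter with `C := conjW 𝕄 S S′ (diagK g) (diagK g′) (diagK (g·g′))` ⇒ every
field–multiplier entry of `C` is zero. -/
theorem conjW_canon_fm_eq_zero_of_twin_border_letter (hc : c ≠ 0)
    (hS : ∀ (x z : Fin (d + 1) → ℤ) (β m : Fin (d + 1)), S z x (Sum.inr m) (Sum.inl β) = S x z (Sum.inl β) (Sum.inr m))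
    (hS' : ∀ (x z : Fin (d + 1) → ℤ) (β m : Fin (d + 1)), S' z x (Sum.inr m) (Sum.inl β) = S' x z (Sum.inl β) (Sum.inr m))
    (h𝕄 : ∀ (x z : Fin (d + 1) → ℤ) (β m : Fin (d + 1)), 𝕄 z x (Sum.inr m) (Sum.inl β) = -𝕄 x z (Sum.inl β) (Sum.inr m))
    (hB₁ : ∀ (x z : Fin (d + 1) → ℤ) (β m : Fin (d + 1)), B₁ z x (Sum.inr m) (Sum.inl β) = B₁ x z (Sum.inl β) (Sum.inr m))
    (hB₀ : ∀ (x z : Fin (d + 1) → ℤ) (β m : Fin (d + 1)), B₀ z x (Sum.inr m) (Sum.inl β) = B₀ x z (Sum.inl β) (Sum.inr m))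
    (hRB : trK RB = -sgnK RB)
    (hfm : ∀ (x z : Fin (d + 1) → ℤ) (β m : Fin (d + 1)),
      (b • B₁) x z (Sum.inl β) (Sum.inr m) =
        (c • refK Φ (b • B₀ + conjW 𝕄 S S' (diagK g) (diagK g') (diagK fun p a => g p a * g' p a) + RB)) x z (Sum.inl β) (Sum.inr m))
    (hmf : ∀ (x z : Fin (d + 1) → ℤ) (m β : Fin (d + 1)),
      (b • B₁) x z (Sum.inr m) (Sum.inl β) =
        (c • refK Φ (b • B₀ + conjW 𝕄 S S' (diagK g) (diagK g') (diagK fun p a => g p a * g' p a) + RB)) x z (Sum.inr m) (Sum.inl β))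
    (x z : Fin (d + 1) → ℤ) (β m : Fin (d + 1)) :
    S' x z (Sum.inl β) (Sum.inr m) * (g z (Sum.inr m) - g x (Sum.inl β)) + S x z (Sum.inl β) (Sum.inr m) * (g' z (Sum.inr m) - g' x (Sum.inl β)) +
      𝕄 x z (Sum.inl β) (Sum.inr m) * ((g x (Sum.inl β) - g z (Sum.inr m)) * (g' x (Sum.inl β) - g' z (Sum.inr m))) = 0 := by
  -- the letter makes `C` twin on the border, the parities make it anti-twin: so its `fm` entries vanish
  have htw := twin_of_border_letter (C := conjW 𝕄 S S' (diagK g) (diagK g') (diagK fun p a => g p a * g' p a)) hc hB₁ hB₀ hRB hfm hmf x z β m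
  rw [conjW_canon_antiTwin hS hS' h𝕄 x z β m] at htw
  have h2 : conjW 𝕄 S S' (diagK g) (diagK g') (diagK fun p a => g p a * g' p a) x z (Sum.inl β) (Sum.inr m) = 0 := by linarith
  rw [conjW_diag_apply] at h2
  linarith

end Abstract

/-! ## §2 The wall reading -/

section Wall

variable {Lc : ℕ} [NeZero Lc] {r : Fin (d + 1) → ℕ} (cE cVH cΛ : ℝ) (γ : ℕ → ℝ) (b : ℝ)
  {vh₂S RB : Fin (d + 1) → (Fin (d + 1) → ℤ) → Fin (d + 1) → (Fin (d + 1) → ℤ) → MKer (d + 1) (Fib d)}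

/-- [folklore] **THE WALL'S BORDER ENTRY CONSTRAINT**: at level `j` and axis `α`, if `vh₂S` is twin on the border, `RB j α`'s rows are parity-odd
and the END's border letter holds on the `fm` and `mf` blocks (letters `SpureRecAt j`, kernel `bhKStepAt j`, generator `γ_j · ctGen`, canonical
second symbol; ANY coefficient `b`), then `γ j · SpureRecAt j κ′ u′ u z (inl α) (inr m) = 0` whenever `κ′ ≠ α` and `m ≠ α`. -/
theorem wall_border_entry_eq_zero_of_twin_letter (hLc : 1 ≤ Lc) (hr : r ∈ box (d + 1) Lc) (j : ℕ) (α : Fin (d + 1))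
    (hBtw : ∀ κ u κ' u' (x z : Fin (d + 1) → ℤ) (β m : Fin (d + 1)),
      vh₂S κ u κ' u' z x (Sum.inr m) (Sum.inl β) = vh₂S κ u κ' u' x z (Sum.inl β) (Sum.inr m))
    (RBα : Fin (d + 1) → (Fin (d + 1) → ℤ) → Fin (d + 1) → (Fin (d + 1) → ℤ) → MKer (d + 1) (Fib d))
    (hRBp : ∀ κ u κ' u', trK (RBα κ u κ' u') = -sgnK (RBα κ u κ' u'))
    (hBfm : ∀ κ u κ' u' (x z : Fin (d + 1) → ℤ) (β m : Fin (d + 1)),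
      (b • vh₂S κ (bref α κ u) κ' (bref α κ' u')) x z (Sum.inl β) (Sum.inr m) =
        ((reflSign α κ * reflSign α κ') • refK (Φ (d := d) Lc α) (b • vh₂S κ u κ' u' +
          conjW (bhKStepAt d (toSite r) Lc j) (SpureRecAt d Lc (toSite r) cE cVH cΛ j κ u) (SpureRecAt d Lc (toSite r) cE cVH cΛ j κ' u')
            (diagK fun p c => γ j * ctGen d α Lc κ u p c) (diagK fun p c => γ j * ctGen d α Lc κ' u' p c)
            (diagK fun p c => γ j ^ 2 * (ctGen d α Lc κ u p c * ctGen d α Lc κ' u' p c)) + RBα κ u κ' u')) x z (Sum.inl β) (Sum.inr m))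
    (hBmf : ∀ κ u κ' u' (x z : Fin (d + 1) → ℤ) (m β : Fin (d + 1)),
      (b • vh₂S κ (bref α κ u) κ' (bref α κ' u')) x z (Sum.inr m) (Sum.inl β) =
        ((reflSign α κ * reflSign α κ') • refK (Φ (d := d) Lc α) (b • vh₂S κ u κ' u' +
          conjW (bhKStepAt d (toSite r) Lc j) (SpureRecAt d Lc (toSite r) cE cVH cΛ j κ u) (SpureRecAt d Lc (toSite r) cE cVH cΛ j κ' u')
            (diagK fun p c => γ j * ctGen d α Lc κ u p c) (diagK fun p c => γ j * ctGen d α Lc κ' u' p c)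
            (diagK fun p c => γ j ^ 2 * (ctGen d α Lc κ u p c * ctGen d α Lc κ' u' p c)) + RBα κ u κ' u')) x z (Sum.inr m) (Sum.inl β))
    (u : Fin (d + 1) → ℤ) {κ' : Fin (d + 1)} (hκ' : κ' ≠ α) (u' z : Fin (d + 1) → ℤ) {m : Fin (d + 1)} (hm : m ≠ α) :
    γ j * SpureRecAt d Lc (toSite r) cE cVH cΛ j κ' u' u z (Sum.inl α) (Sum.inr m) = 0 := by
  classical
  have hc : reflSign α α * reflSign α κ' ≠ 0 := by
    intro h0
    have := congrArg (fun t => t * (reflSign α α * reflSign α κ')) h0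
    simp only [zero_mul] at this
    have h3 : reflSign α α * reflSign α α * (reflSign α κ' * reflSign α κ') = 0 := by
      calc _ = reflSign α α * reflSign α κ' * (reflSign α α * reflSign α κ') := by ring
        _ = 0 := this
    rw [reflSign_mul_self, reflSign_mul_self, one_mul] at h3
    exact one_ne_zero h3
  have hSt : ∀ (κ₀ : Fin (d + 1)) (u₀ x z : Fin (d + 1) → ℤ) (β m : Fin (d + 1)),
      SpureRecAt d Lc (toSite r) cE cVH cΛ j κ₀ u₀ z x (Sum.inr m) (Sum.inl β) = SpureRecAt d Lc (toSite r) cE cVH cΛ j κ₀ u₀ x z (Sum.inl β) (Sum.inr m) :=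
    fun κ₀ u₀ x z β m => twin_of_parityOdd (trK_SpureRecAt hLc hr cE cVH cΛ j κ₀ u₀) x z β m
  -- the symbol product is the canonical second symbol of the pair of generators `γ_j ĝ`, `γ_j ĝ′`
  have hcan : (diagK fun p c => γ j ^ 2 * (ctGen d α Lc α u p c * ctGen d α Lc κ' u' p c)) =
      diagK fun p a => (γ j * ctGen d α Lc α u p a) * (γ j * ctGen d α Lc κ' u' p a) := by
    congr 1; funext p a; ring
  have key := conjW_canon_fm_eq_zero_of_twin_border_letter (Φ := Φ (d := d) Lc α) (b := b)
    (g := fun p c => γ j * ctGen d α Lc α u p c) (g' := fun p c => γ j * ctGen d α Lc κ' u' p c) hc (hSt α u) (hSt κ' u')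
    (fun x z β m => antiTwin_of_parityEven (trK_bhKStepAt (toSite r) Lc j) x z β m) (hBtw α (bref α α u) κ' (bref α κ' u')) (hBtw α u κ' u')
    (hRBp α u κ' u') (fun x z β m => by rw [← hcan]; exact hBfm α u κ' u' x z β m) (fun x z m β => by rw [← hcan]; exact hBmf α u κ' u' x z m β)
    u z α m
  -- evaluate the generators at the chosen entry
  have e1 : ctGen d α Lc α u u (Sum.inl α) = -1 := by rw [ctGen_inl, if_pos ⟨rfl, rfl, rfl⟩]
  have e2 : ctGen d α Lc α u z (Sum.inr m) = 0 := by rw [ctGen_inr, if_neg (fun h => hm h.1)]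
  have e3 : ctGen d α Lc κ' u' u (Sum.inl α) = 0 := by rw [ctGen_inl, if_neg (fun h => hκ' h.2.2)]
  have e4 : ctGen d α Lc κ' u' z (Sum.inr m) = 0 := by rw [ctGen_inr, if_neg (fun h => hm h.1)]
  simp only [e1, e2, e3, e4] at key
  linarith

/-- [folklore] **NO TWIN MODEL OF THE BORDER SOCKET**: with `γ j ≠ 0` and ONE entry `SpureRecAt j κ′ u′ u z (inl α) (inr m) ≠ 0` (`κ′ ≠ α`,
`m ≠ α`), no twin `vh₂S` and parity-odd `RB j α` satisfy both border blocks of the END's letter at `(j, α)` (any coefficient `b`). -/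
theorem no_twin_border_model (hLc : 1 ≤ Lc) (hr : r ∈ box (d + 1) Lc) (j : ℕ) (α : Fin (d + 1)) (hγ : γ j ≠ 0)
    (hBtw : ∀ κ u κ' u' (x z : Fin (d + 1) → ℤ) (β m : Fin (d + 1)),
      vh₂S κ u κ' u' z x (Sum.inr m) (Sum.inl β) = vh₂S κ u κ' u' x z (Sum.inl β) (Sum.inr m))
    {u : Fin (d + 1) → ℤ} {κ' : Fin (d + 1)} (hκ' : κ' ≠ α) {u' z : Fin (d + 1) → ℤ} {m : Fin (d + 1)} (hm : m ≠ α)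
    (hne : SpureRecAt d Lc (toSite r) cE cVH cΛ j κ' u' u z (Sum.inl α) (Sum.inr m) ≠ 0) :
    ¬ ∃ RBα : Fin (d + 1) → (Fin (d + 1) → ℤ) → Fin (d + 1) → (Fin (d + 1) → ℤ) → MKer (d + 1) (Fib d),
      (∀ κ u κ' u', trK (RBα κ u κ' u') = -sgnK (RBα κ u κ' u')) ∧
      (∀ κ u κ' u' (x z : Fin (d + 1) → ℤ) (β m : Fin (d + 1)),
        (b • vh₂S κ (bref α κ u) κ' (bref α κ' u')) x z (Sum.inl β) (Sum.inr m) =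
          ((reflSign α κ * reflSign α κ') • refK (Φ (d := d) Lc α) (b • vh₂S κ u κ' u' +
            conjW (bhKStepAt d (toSite r) Lc j) (SpureRecAt d Lc (toSite r) cE cVH cΛ j κ u) (SpureRecAt d Lc (toSite r) cE cVH cΛ j κ' u')
              (diagK fun p c => γ j * ctGen d α Lc κ u p c) (diagK fun p c => γ j * ctGen d α Lc κ' u' p c)
              (diagK fun p c => γ j ^ 2 * (ctGen d α Lc κ u p c * ctGen d α Lc κ' u' p c)) + RBα κ u κ' u')) x z (Sum.inl β) (Sum.inr m)) ∧
      (∀ κ u κ' u' (x z : Fin (d + 1) → ℤ) (m β : Fin (d + 1)),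
        (b • vh₂S κ (bref α κ u) κ' (bref α κ' u')) x z (Sum.inr m) (Sum.inl β) =
          ((reflSign α κ * reflSign α κ') • refK (Φ (d := d) Lc α) (b • vh₂S κ u κ' u' +
            conjW (bhKStepAt d (toSite r) Lc j) (SpureRecAt d Lc (toSite r) cE cVH cΛ j κ u) (SpureRecAt d Lc (toSite r) cE cVH cΛ j κ' u')
              (diagK fun p c => γ j * ctGen d α Lc κ u p c) (diagK fun p c => γ j * ctGen d α Lc κ' u' p c)
              (diagK fun p c => γ j ^ 2 * (ctGen d α Lc κ u p c * ctGen d α Lc κ' u' p c)) + RBα κ u κ' u')) x z (Sum.inr m) (Sum.inl β)) := by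
  rintro ⟨RBα, hRBp, hBfm, hBmf⟩
  have h := wall_border_entry_eq_zero_of_twin_letter cE cVH cΛ γ b hLc hr j α hBtw RBα hRBp hBfm hBmf u hκ' u' z hm
  exact hne ((mul_eq_zero.1 h).resolve_left hγ)

end Wall

end

end Summit.QuantumFields.BalabanUV.Beta.SecondOrderBorderNoModel
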